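import Summits.Ventures.HodgeRepro2.A2HardLefschetzMain

/-!
# The primitive splitting `⋀^k = P^k ⊕ L ⋀^{k−2}` of the model (A2 annex, sl₂ — part 1)

In the twelve-plane model (`L = θ ∧ ·`, `Λ = Σ c_p⁻¹ Λ_p`, `[Λ, L] = n − k` on `⋀^k`, row 101;
hard Lefschetz, row 102) a class `v ∈ ⋀^k` is PRIMITIVE if `Λ v = 0`.  This file proves the
sl₂-facts behind Voisin's Prop. 6.22 / Cor. 6.26 at the first level:

* a primitive class of degree `d > n` is zero (`eq_zero_of_lam_eq_zero_of_card_lt`), hence a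
  primitive class of degree `k ≤ n` is killed by `L^{n−k+1}` (`lef_pow_succ_eq_zero_of_primitive`);
* `Λ L` is a bijection of `⋀^{k−2}` for `k ≤ n` (`lamLef_bijective`);
* every `x ∈ ⋀^k`, `k ≤ n`, is UNIQUELY `x = v + L y` with `v` primitive of degree `k` and
  `y ∈ ⋀^{k−2}` (`exists_unique_primitive_splitting`); `primPart x` / `lefPart x` are the two
  components.
-/

namespace Summit.Ventures.HodgeRepro2.A2LefschetzSplitting

open WeilPlanes WeilCoproduct A2HardLefschetzOps A2HardLefschetzMain

variable {ι : Type*} [DecidableEq ι] [Fintype ι]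

/-- A class of degree `m > 2n` is zero (`⋀^m = 0`). -/
theorem eq_zero_of_mem_grading_of_lt {m : ℕ} (hm : 2 * Fintype.card ι < m) {x : A ι}
    (hx : x ∈ grading ι m) : x = 0 := by
  have h0 : Module.finrank ℂ (grading ι m) = 0 := by
    rw [finrank_grading, Nat.choose_eq_zero_of_lt hm]
  have hbot : grading ι m = ⊥ := Submodule.finrank_eq_zero.1 h0
  rw [hbot] at hx
  exact (Submodule.mem_bot ℂ).1 hx

/-- **A primitive class of degree `d > n` is zero**: `Λ L^j v = j(n−d−j+1) L^{j−1} v` with all the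
coefficients non-zero, and `L^j v = 0` for `d + 2j > 2n`. -/
theorem eq_zero_of_lam_eq_zero_of_card_lt {c : ι → ℂ} (hc : ∀ p, c p ≠ 0) {d : ℕ}
    (hd : Fintype.card ι < d) {v : A ι} (hv : v ∈ grading ι d) (hprim : lam c v = 0) : v = 0 := by
  -- `L^j v = 0 ⇒ v = 0` for every `j`, by induction on `j`
  have key : ∀ j : ℕ, (lef c ^ j) v = 0 → v = 0 := by
    intro j
    induction j with
    | zero => intro h; simpa using h
    | succ j ih =>
      intro h
      have h1 := lam_lef_pow hc hv j
      rw [h, map_zero, hprim, map_zero, zero_add] at h1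
      have hcoef : ((j : ℂ) + 1) * ((Fintype.card ι : ℂ) - d - j) ≠ 0 := by
        refine mul_ne_zero ?_ ?_
        · exact_mod_cast Nat.succ_ne_zero j
        · intro h0
          have : (Fintype.card ι : ℂ) = d + j := by linear_combination h0
          have : Fintype.card ι = d + j := by exact_mod_cast this
          omega
      exact ih ((smul_eq_zero.1 h1.symm).resolve_left hcoef)
  refine key (Fintype.card ι) ?_
  exact eq_zero_of_mem_grading_of_lt (by omega) (lef_pow_mem_grading c (Fintype.card ι) hv)

/-- **A primitive class of degree `k ≤ n` is killed by `L^{n−k+1}`**: `Λ L^{n−k+1} v = 0`, so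
`L^{n−k+1} v` is primitive of degree `2n − k + 2 > n`, hence zero. -/
theorem lef_pow_succ_eq_zero_of_primitive {c : ι → ℂ} (hc : ∀ p, c p ≠ 0) {k : ℕ}
    (hk : k ≤ Fintype.card ι) {v : A ι} (hv : v ∈ grading ι k) (hprim : lam c v = 0) :
    (lef c ^ (Fintype.card ι - k + 1)) v = 0 := by
  have h1 := lam_lef_pow hc hv (Fintype.card ι - k)
  rw [hprim, map_zero, zero_add] at h1
  have hcoef : (((Fintype.card ι - k : ℕ) : ℂ) + 1) *
      ((Fintype.card ι : ℂ) - k - ((Fintype.card ι - k : ℕ) : ℂ)) = 0 := by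
    rw [Nat.cast_sub hk]
    ring
  rw [hcoef, zero_smul] at h1
  refine eq_zero_of_lam_eq_zero_of_card_lt hc (d := k + 2 * (Fintype.card ι - k + 1)) (by omega)
    (lef_pow_mem_grading c _ hv) h1

/-- `Λ L` maps `⋀^{k−2}` to itself. -/
lemma lamLef_mem (c : ι → ℂ) {d : ℕ} {y : A ι} (hy : y ∈ grading ι d) :
    lam c (lef c y) ∈ grading ι d :=
  lam_mem_grading c (lef_mem_grading c hy)

/-- **`Λ L` is injective on `⋀^{k−2}` for `k ≤ n`**: if `Λ L y = 0` then `L y` is primitive of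
degree `k`, so `L^{n−k+2} y = 0`, so `y = 0` by the injectivity of `L^{n−k+2}` on `⋀^{k−2}`. -/
theorem lamLef_injective {c : ι → ℂ} (hc : ∀ p, c p ≠ 0) {d : ℕ} (hd : d + 2 ≤ Fintype.card ι)
    {y : A ι} (hy : y ∈ grading ι d) (h : lam c (lef c y) = 0) : y = 0 := by
  have h1 := lef_pow_succ_eq_zero_of_primitive hc (k := d + 2) hd (lef_mem_grading c hy) h
  rw [← Module.End.mul_apply, ← pow_succ] at h1
  exact eq_zero_of_lef_pow_eq_zero hc hy (m := Fintype.card ι - (d + 2) + 1 + 1) (by omega) h1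

/-- `Λ L` restricted to `⋀^d`. -/
noncomputable def lamLefRestrict (c : ι → ℂ) (d : ℕ) : grading ι d →ₗ[ℂ] grading ι d :=
  (lam c ∘ₗ lef c).restrict fun _ hy => lamLef_mem c hy

/-- **`Λ L` is a bijection of `⋀^d` for `d + 2 ≤ n`** (injective, finite dimension). -/
theorem lamLefRestrict_bijective {c : ι → ℂ} (hc : ∀ p, c p ≠ 0) {d : ℕ}
    (hd : d + 2 ≤ Fintype.card ι) : Function.Bijective (lamLefRestrict c d) := by
  have hinj : Function.Injective (lamLefRestrict c d) := by
    intro y y' hyy'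
    have h : lam c (lef c ((y : A ι) - y')) = 0 := by
      have := congrArg Subtype.val hyy'
      simp only [lamLefRestrict, LinearMap.coe_restrict_apply, LinearMap.comp_apply] at this
      rw [map_sub, map_sub, this, sub_self]
    have := lamLef_injective hc hd (Submodule.sub_mem _ y.2 y'.2) h
    exact Subtype.ext (sub_eq_zero.1 this)
  exact ⟨hinj, LinearMap.injective_iff_surjective.1 hinj⟩

/-- **Existence of the primitive splitting**: for `x ∈ ⋀^k`, `k ≤ n`, there are `v` primitive of
degree `k` and `y ∈ ⋀^{k−2}` with `x = v + L y` (for `k < 2` take `y = 0`). -/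
theorem exists_primitive_splitting {c : ι → ℂ} (hc : ∀ p, c p ≠ 0) {k : ℕ}
    (hk : k ≤ Fintype.card ι) {x : A ι} (hx : x ∈ grading ι k) :
    ∃ v y : A ι, v ∈ grading ι k ∧ lam c v = 0 ∧ y ∈ grading ι (k - 2) ∧ x = v + lef c y := by
  by_cases hk2 : k < 2
  · exact ⟨x, 0, hx, lam_eq_zero_of_mem_lt_two c hk2 hx, Submodule.zero_mem _, by simp⟩
  · have hd : k - 2 + 2 ≤ Fintype.card ι := by omega
    have hΛx : lam c x ∈ grading ι (k - 2) := by
      have := lam_mem_grading c (k := k - 2) (by rwa [show k - 2 + 2 = k by omega])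
      exact this
    obtain ⟨y, hy⟩ := (lamLefRestrict_bijective hc hd).2 ⟨lam c x, hΛx⟩
    have hy' : lam c (lef c (y : A ι)) = lam c x := by
      have := congrArg Subtype.val hy
      simpa [lamLefRestrict, LinearMap.coe_restrict_apply] using this
    refine ⟨x - lef c y, y, ?_, ?_, y.2, by abel⟩
    · have h2 : lef c (y : A ι) ∈ grading ι (k - 2 + 2) := lef_mem_grading c y.2
      rw [show k - 2 + 2 = k by omega] at h2
      exact Submodule.sub_mem _ hx h2
    · rw [map_sub, hy', sub_self]

/-- **Uniqueness of the primitive splitting**: if `v + L y = v' + L y'` with `v, v'` primitive,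
`2 ≤ k ≤ n` and `y, y' ∈ ⋀^{k−2}`, then `v = v'` and `y = y'`. -/
theorem primitive_splitting_unique {c : ι → ℂ} (hc : ∀ p, c p ≠ 0) {k : ℕ} (hk2 : 2 ≤ k)
    (hk : k ≤ Fintype.card ι) {v v' y y' : A ι} (hv : lam c v = 0) (hv' : lam c v' = 0)
    (hy : y ∈ grading ι (k - 2)) (hy' : y' ∈ grading ι (k - 2))
    (h : v + lef c y = v' + lef c y') : v = v' ∧ y = y' := by
  have hd : k - 2 + 2 ≤ Fintype.card ι := by omega
  have hΛ : lam c (lef c (y - y')) = 0 := by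
    have := congrArg (lam c) h
    rw [map_add, map_add, hv, hv', zero_add, zero_add] at this
    rw [map_sub, map_sub, this, sub_self]
  have hyy : y - y' = 0 := lamLef_injective hc hd (Submodule.sub_mem _ hy hy') hΛ
  have hyy' : y = y' := sub_eq_zero.1 hyy
  subst hyy'
  exact ⟨add_right_cancel h, rfl⟩

/-- The primitive component of `x ∈ ⋀^k`, `k ≤ n` (for `k < 2` the class itself). -/
noncomputable def primPart (c : ι → ℂ) (hc : ∀ p, c p ≠ 0) {k : ℕ} (hk : k ≤ Fintype.card ι)
    {x : A ι} (hx : x ∈ grading ι k) : A ι :=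
  if k < 2 then x else Classical.choose (exists_primitive_splitting hc hk hx)

/-- The `L`-component of `x ∈ ⋀^k`, `k ≤ n`: `x = primPart x + L (lefPart x)` (for `k < 2`, `0`). -/
noncomputable def lefPart (c : ι → ℂ) (hc : ∀ p, c p ≠ 0) {k : ℕ} (hk : k ≤ Fintype.card ι)
    {x : A ι} (hx : x ∈ grading ι k) : A ι :=
  if k < 2 then 0 else
    Classical.choose (Classical.choose_spec (exists_primitive_splitting hc hk hx))

/-- The defining properties of the splitting. -/
theorem primPart_spec (c : ι → ℂ) (hc : ∀ p, c p ≠ 0) {k : ℕ} (hk : k ≤ Fintype.card ι)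
    {x : A ι} (hx : x ∈ grading ι k) :
    primPart c hc hk hx ∈ grading ι k ∧ lam c (primPart c hc hk hx) = 0 ∧
      lefPart c hc hk hx ∈ grading ι (k - 2) ∧
        x = primPart c hc hk hx + lef c (lefPart c hc hk hx) := by
  by_cases hk2 : k < 2
  · simp only [primPart, lefPart, if_pos hk2]
    exact ⟨hx, lam_eq_zero_of_mem_lt_two c hk2 hx, Submodule.zero_mem _, by simp⟩
  · simp only [primPart, lefPart, if_neg hk2]
    exact Classical.choose_spec (Classical.choose_spec (exists_primitive_splitting hc hk hx))

/-- `primPart x ∈ ⋀^k`. -/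
theorem primPart_mem (c : ι → ℂ) (hc : ∀ p, c p ≠ 0) {k : ℕ} (hk : k ≤ Fintype.card ι)
    {x : A ι} (hx : x ∈ grading ι k) : primPart c hc hk hx ∈ grading ι k :=
  (primPart_spec c hc hk hx).1

/-- `primPart x` is primitive. -/
theorem lam_primPart (c : ι → ℂ) (hc : ∀ p, c p ≠ 0) {k : ℕ} (hk : k ≤ Fintype.card ι)
    {x : A ι} (hx : x ∈ grading ι k) : lam c (primPart c hc hk hx) = 0 :=
  (primPart_spec c hc hk hx).2.1

/-- `lefPart x ∈ ⋀^{k−2}`. -/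
theorem lefPart_mem (c : ι → ℂ) (hc : ∀ p, c p ≠ 0) {k : ℕ} (hk : k ≤ Fintype.card ι)
    {x : A ι} (hx : x ∈ grading ι k) : lefPart c hc hk hx ∈ grading ι (k - 2) :=
  (primPart_spec c hc hk hx).2.2.1

/-- `x = primPart x + θ ∧ lefPart x`. -/
theorem primPart_add_lef_lefPart (c : ι → ℂ) (hc : ∀ p, c p ≠ 0) {k : ℕ} (hk : k ≤ Fintype.card ι)
    {x : A ι} (hx : x ∈ grading ι k) :
    x = primPart c hc hk hx + theta c * lefPart c hc hk hx :=
  (primPart_spec c hc hk hx).2.2.2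

/-- **The primitive component is characterised by the splitting**: if `x = v + L y` with `v`
primitive, `2 ≤ k` and `y ∈ ⋀^{k−2}`, then `v = primPart x`. -/
theorem primPart_eq_of_eq (c : ι → ℂ) (hc : ∀ p, c p ≠ 0) {k : ℕ} (hk2 : 2 ≤ k)
    (hk : k ≤ Fintype.card ι) {x : A ι} (hx : x ∈ grading ι k) {v y : A ι} (hv : lam c v = 0)
    (hy : y ∈ grading ι (k - 2)) (h : x = v + lef c y) : v = primPart c hc hk hx :=
  (primitive_splitting_unique hc hk2 hk hv (lam_primPart c hc hk hx) hy (lefPart_mem c hc hk hx)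
    (h.symm.trans (primPart_add_lef_lefPart c hc hk hx))).1

/-- A primitive class is its own primitive component. -/
theorem primPart_of_primitive (c : ι → ℂ) (hc : ∀ p, c p ≠ 0) {k : ℕ} (hk : k ≤ Fintype.card ι)
    {v : A ι} (hv : v ∈ grading ι k) (hprim : lam c v = 0) : primPart c hc hk hv = v := by
  by_cases hk2 : k < 2
  · simp only [primPart, if_pos hk2]
  · exact (primPart_eq_of_eq c hc (by omega) hk hv hprim (Submodule.zero_mem _) (by simp)).symm

/-- The primitive component of `L y`, `y ∈ ⋀^{k−2}`, `2 ≤ k`, is zero. -/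
theorem primPart_lef (c : ι → ℂ) (hc : ∀ p, c p ≠ 0) {k : ℕ} (hk2 : 2 ≤ k)
    (hk : k ≤ Fintype.card ι) {y : A ι} (hy : y ∈ grading ι (k - 2))
    (hLy : lef c y ∈ grading ι k) : primPart c hc hk hLy = 0 :=
  (primPart_eq_of_eq c hc hk2 hk hLy (map_zero _) hy (by simp)).symm

end Summit.Ventures.HodgeRepro2.A2LefschetzSplitting
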